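import Summits.QuantumFields.YangMills.Theorems.IR.TensionRatioPlaquetteFloorTorusExpansion
import HarnessLib

/-!
# Crux `IR` (stmt-QuantumFields-19354), line `tension-ratio`, input `PlaquetteFloorSC` — part 5:
# the numerator of the `π`-plaquette expectation to order `k`, uniformly in the volume

Pooled prover `ym-ir-line-pool-p3` (gen 3).  Helper module for item `stmt-QuantumFields-19354` (`--supports`; it closes
nothing).  Setting of part 4 (torus `(ℤ/L)⁴`, `L ≥ 2`, product Haar `dU`, unitary continuous `ρ`, probe `π`,
`obs = Re tr π(U_{p₀})`, a finite set `A ∋ p₀` of plaquettes outside which nothing reads a bond of `p₀`, `S = S_A + S_B`,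
`R = e^{−βS_B}`, order `k` of part 2):

* §3 `integral_obs_taylor_mul_eq`: `∫ obs · (∑_{j≤k} (−βS_A)^j/j!) · R dU = (β^k/k!) c ∫ R dU`, `c = ∫_G Re tr π (Re tr ρ)^k`
  (expand `S_A^j` over tuples of plaquettes of `A`; all monomials vanish by part 4 §1 except `cost(p₀)^k`, evaluated by
  part 4 §2);
* §4 `integral_obs_mul_exp_ge`: with `|Re tr π| ≤ C_π`, `X = |A|·2N` and `βX ≤ 1`,
  `((β^k/k!) c − 2 C_π X^{k+1} β^{k+1}) ∫ R dU ≤ ∫ obs e^{−βS} dU` (Taylor remainder `|e^{-t} − T_k(t)| ≤ 2t^{k+1}` on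
  `[0,1]`), and `integral_exp_le_integral_R`: `∫ e^{−βS} dU ≤ ∫ R dU` (costs are non-negative) — the whole volume-uniformity.

Everything is proved; no new definitions; nothing here bears on the Yang–Mills mass gap.
-/

set_option autoImplicit false

noncomputable section

open MeasureTheory Finset Function
open Literature.MathematicalPhysics.QuantumFieldTheory
open Summit.QuantumFields.YangMills.Cruxes.IR.SCFloor (mem_pedges plaquetteHolonomy_update_of_not_mem
  integral_pi_eq_integral_integral_update integral_update_plaquetteHolonomy)

namespace Summit.QuantumFields.YangMills.Cruxes.IR.TensionRatio.PlaquetteFloor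

variable {L : ℕ} {G : Type*} [Group G] [TopologicalSpace G] [IsTopologicalGroup G] [CompactSpace G]
  [MeasurableSpace G] [BorelSpace G] [SecondCountableTopology G] {m N : ℕ}
  (π : G →* Matrix (Fin m) (Fin m) ℂ) (ρ : G →* Matrix (Fin N) (Fin N) ℂ)

section Numerator

variable [NeZero L] [Fact (1 < L)]

/-! ## §3 The Taylor polynomial part and the remainder -/

/-- **The Taylor polynomial of degree `k` picks exactly the floor coefficient**:
`∫ obs · (∑_{j≤k} (−βS_A)^j/j!) · R dU = (β^k/k!) (∫_G Re tr π (Re tr ρ)^k) · ∫ R dU`. -/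
theorem integral_obs_taylor_mul_eq (hπ : Continuous π) (hρ : Continuous ρ)
    (hρu : ∀ g, ρ g ∈ Matrix.unitaryGroup (Fin N) ℂ) {k : ℕ}
    (hV : ∀ n < k, ∀ (K : Matrix (Fin m) (Fin m) ℂ) (M : Fin n → Matrix (Fin N) (Fin N) ℂ),
      ∫ g, (π g * K).trace.re * ∏ i, (ρ g * M i).trace.re ∂haarProbability G = 0)
    (A : Finset (Plaquette 4 L)) (hp₀ : ((0 : Site 4 L), ⟨((0 : Fin 4), (1 : Fin 4)), Fin.zero_lt_one⟩) ∈ A)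
    (hA : ∀ q ∉ A, ∀ e ∈ ({((0 : Site 4 L), (0 : Fin 4)), ((0 : Site 4 L).shift 0, (1 : Fin 4)),
        ((0 : Site 4 L).shift 1, (0 : Fin 4)), ((0 : Site 4 L), (1 : Fin 4))} : Finset (Edge 4 L)),
      e ∉ ({(q.1, q.2.1.1), (q.1.shift q.2.1.1, q.2.1.2), (q.1.shift q.2.1.2, q.2.1.1), (q.1, q.2.1.2)} : Finset (Edge 4 L)))
    {β : ℝ} (hβ : 0 ≤ β) :
    ∫ U, (π (plaquetteHolonomy U 0 0 1)).trace.re *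
        (∑ j ∈ Finset.range (k + 1), (-(β * ∑ q ∈ A, plaquetteCost ρ U q)) ^ j / (j.factorial : ℝ)) *
        Real.exp (-β * ∑ q ∈ Aᶜ, plaquetteCost ρ U q) ∂(Measure.pi fun _ : Edge 4 L => haarProbability G) =
      (β ^ k / (k.factorial : ℝ)) * (∫ h, (π h).trace.re * ((ρ h).trace.re) ^ k ∂haarProbability G) *
        ∫ U, Real.exp (-β * ∑ q ∈ Aᶜ, plaquetteCost ρ U q) ∂(Measure.pi fun _ : Edge 4 L => haarProbability G) := by
  classical
  set μ : Measure (GaugeConfig 4 L G) := Measure.pi fun _ : Edge 4 L => haarProbability G with hμ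
  set p₀ : Plaquette 4 L := ((0 : Site 4 L), ⟨((0 : Fin 4), (1 : Fin 4)), Fin.zero_lt_one⟩) with hp₀def
  -- expand powers of `S_A` over tuples of plaquettes of `A`
  have hexp : ∀ U : GaugeConfig 4 L G,
      (π (plaquetteHolonomy U 0 0 1)).trace.re *
          (∑ j ∈ Finset.range (k + 1), (-(β * ∑ q ∈ A, plaquetteCost ρ U q)) ^ j / (j.factorial : ℝ)) *
          Real.exp (-β * ∑ q ∈ Aᶜ, plaquetteCost ρ U q) =
        ∑ j ∈ Finset.range (k + 1), ∑ f ∈ Fintype.piFinset (fun _ : Fin j => A),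
          ((-β) ^ j / (j.factorial : ℝ)) * ((π (plaquetteHolonomy U 0 0 1)).trace.re *
            (∏ a, plaquetteCost ρ U (f a)) * Real.exp (-β * ∑ q ∈ Aᶜ, plaquetteCost ρ U q)) := by
    intro U
    rw [Finset.mul_sum, Finset.sum_mul]
    refine Finset.sum_congr rfl fun j _ => ?_
    rw [neg_mul_eq_neg_mul, mul_pow, Finset.sum_pow', Finset.mul_sum, Finset.sum_div, Finset.mul_sum, Finset.sum_mul]
    refine Finset.sum_congr rfl fun f _ => ?_
    ring
  -- integrability of the monomials
  obtain ⟨Cπ, hCπ⟩ : ∃ C : ℝ, ∀ h : G, |(π h).trace.re| ≤ C := by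
    obtain ⟨C, hC⟩ := isCompact_univ.exists_bound_of_continuousOn
      (Complex.continuous_re.comp hπ.matrix_trace).continuousOn
    exact ⟨C, fun h => Real.norm_eq_abs _ ▸ hC h (Set.mem_univ h)⟩
  have hRm : Measurable fun U : GaugeConfig 4 L G => Real.exp (-β * ∑ q ∈ Aᶜ, plaquetteCost ρ U q) :=
    Real.measurable_exp.comp ((Finset.measurable_sum _ fun q _ => measurable_plaquetteCost' ρ hρ q).const_mul _)
  have hRb : ∀ U : GaugeConfig 4 L G, |Real.exp (-β * ∑ q ∈ Aᶜ, plaquetteCost ρ U q)| ≤ 1 := fun U => by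
    rw [abs_of_nonneg (Real.exp_pos _).le, Real.exp_le_one_iff, neg_mul, neg_nonpos]
    exact mul_nonneg hβ (Finset.sum_nonneg fun q _ => (plaquetteCost_bounds ρ hρu U q).1)
  have hint : ∀ (j : ℕ) (f : Fin j → Plaquette 4 L), Integrable
      (fun U => ((-β) ^ j / (j.factorial : ℝ)) * ((π (plaquetteHolonomy U 0 0 1)).trace.re *
        (∏ a, plaquetteCost ρ U (f a)) * Real.exp (-β * ∑ q ∈ Aᶜ, plaquetteCost ρ U q))) μ := by
    intro j f
    refine Integrable.of_bound (C := |(-β) ^ j / (j.factorial : ℝ)| * (Cπ * (2 * N) ^ j * 1)) ?_ (ae_of_all _ fun U => ?_)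
    · exact (measurable_const.mul ((((Complex.continuous_re.comp hπ.matrix_trace).measurable.comp
        (measurable_plaquetteHolonomy _ _ _)).mul (Finset.measurable_prod _ fun a _ =>
          measurable_plaquetteCost' ρ hρ (f a))).mul hRm)).aestronglyMeasurable
    · rw [Real.norm_eq_abs, abs_mul, abs_mul, abs_mul, Finset.abs_prod]
      refine mul_le_mul_of_nonneg_left ?_ (abs_nonneg _)
      have hprod : ∏ a, |plaquetteCost ρ U (f a)| ≤ (2 * N) ^ j := by
        calc ∏ a, |plaquetteCost ρ U (f a)| ≤ ∏ _a : Fin j, (2 * (N : ℝ)) :=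
              Finset.prod_le_prod (fun a _ => abs_nonneg _) fun a _ => by
                rw [abs_of_nonneg (plaquetteCost_bounds ρ hρu U (f a)).1]
                exact (plaquetteCost_bounds ρ hρu U (f a)).2
          _ = (2 * N) ^ j := by simp
      exact mul_le_mul (mul_le_mul (hCπ _) hprod (Finset.prod_nonneg fun _ _ => abs_nonneg _)
        (le_trans (abs_nonneg _) (hCπ 1))) (hRb U) (abs_nonneg _)
        (mul_nonneg (le_trans (abs_nonneg _) (hCπ 1)) (by positivity))
  -- integrate term by term
  simp_rw [hexp]
  rw [integral_finsetSum _ fun j _ => integrable_finsetSum _ fun f _ => hint j f]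
  simp_rw [integral_finsetSum _ fun f _ => hint _ f, integral_const_mul]
  -- degrees `j < k` vanish; at degree `k` only `f ≡ p₀` survives
  rw [Finset.sum_range_succ, Finset.sum_eq_zero fun j hj => ?_, zero_add]
  · rw [Finset.sum_eq_single (fun _ : Fin k => p₀)]
    · simp only [Finset.prod_const, Finset.card_univ, Fintype.card_fin, hp₀def]
      have hRbl : ∀ (U : GaugeConfig 4 L G) (g : G),
          Real.exp (-β * ∑ q ∈ Aᶜ, plaquetteCost ρ (update U ((0 : Site 4 L), (0 : Fin 4)) g) q) =
            Real.exp (-β * ∑ q ∈ Aᶜ, plaquetteCost ρ U q) := fun U g => by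
        congr 2
        exact Finset.sum_congr rfl fun q hq =>
          plaquetteCost_update_of_not_mem ρ q U (hA q (Finset.mem_compl.1 hq) _ (by simp)) g
      have hE3 := integral_obs_cost_pow_mul_eq (L := L) π ρ hπ hρ hρu k
        (fun U => Real.exp (-β * ∑ q ∈ Aᶜ, plaquetteCost ρ U q)) hRm hRb hRbl
      beta_reduce at hE3
      rw [hE3, integral_re_trace_mul_sub_pow π ρ hπ hρ hV, neg_pow β k, ← hμ]
      have h1 : ((-1 : ℝ) ^ k) * (-1) ^ k = 1 := by rw [← pow_add, ← two_mul, pow_mul, neg_one_sq, one_pow]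
      linear_combination (β ^ k / (k.factorial : ℝ) *
        (∫ h, (π h).trace.re * ((ρ h).trace.re) ^ k ∂haarProbability G) *
          ∫ U, Real.exp (-β * ∑ q ∈ Aᶜ, plaquetteCost ρ U q) ∂μ) * h1
    · intro f _ hf
      rw [integral_obs_prod_cost_eq_zero_of_ne π ρ hπ hρ hρu hV A hA hβ f hf, mul_zero]
    · intro h
      exact absurd (Fintype.mem_piFinset.2 fun _ => hp₀) h
  · refine Finset.sum_eq_zero fun f _ => ?_
    rw [integral_obs_prod_cost_eq_zero_of_lt π ρ hπ hρ hρu hV A hA hβ (Finset.mem_range.1 hj) f, mul_zero]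

/-! ## §4 The numerator of the `π`-plaquette expectation to order `k` -/

/-- **Numerator bound.**  With `R = e^{−βS_B}`, `c = ∫_G Re tr π (Re tr ρ)^k`, `|Re tr π| ≤ C_π`, `X = |A|·2N ≥ S_A` and
`βX ≤ 1`:  `((β^k/k!) c − 2 C_π X^{k+1} β^{k+1}) ∫ R dU ≤ ∫ Re tr π(U_{p₀}) e^{−βS(U)} dU`. -/
theorem integral_obs_mul_exp_ge (hπ : Continuous π) (hρ : Continuous ρ)
    (hρu : ∀ g, ρ g ∈ Matrix.unitaryGroup (Fin N) ℂ) {k : ℕ}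
    (hV : ∀ n < k, ∀ (K : Matrix (Fin m) (Fin m) ℂ) (M : Fin n → Matrix (Fin N) (Fin N) ℂ),
      ∫ g, (π g * K).trace.re * ∏ i, (ρ g * M i).trace.re ∂haarProbability G = 0)
    (A : Finset (Plaquette 4 L)) (hp₀ : ((0 : Site 4 L), ⟨((0 : Fin 4), (1 : Fin 4)), Fin.zero_lt_one⟩) ∈ A)
    (hA : ∀ q ∉ A, ∀ e ∈ ({((0 : Site 4 L), (0 : Fin 4)), ((0 : Site 4 L).shift 0, (1 : Fin 4)),
        ((0 : Site 4 L).shift 1, (0 : Fin 4)), ((0 : Site 4 L), (1 : Fin 4))} : Finset (Edge 4 L)),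
      e ∉ ({(q.1, q.2.1.1), (q.1.shift q.2.1.1, q.2.1.2), (q.1.shift q.2.1.2, q.2.1.1), (q.1, q.2.1.2)} : Finset (Edge 4 L)))
    {Cπ : ℝ} (hCπ : ∀ h : G, |(π h).trace.re| ≤ Cπ) {β : ℝ} (hβ : 0 ≤ β) (hβA : β * (A.card * (2 * N)) ≤ 1) :
    (β ^ k / (k.factorial : ℝ) * (∫ h, (π h).trace.re * ((ρ h).trace.re) ^ k ∂haarProbability G) -
        2 * Cπ * (A.card * (2 * N)) ^ (k + 1) * β ^ (k + 1)) *
        ∫ U, Real.exp (-β * ∑ q ∈ Aᶜ, plaquetteCost ρ U q) ∂(Measure.pi fun _ : Edge 4 L => haarProbability G) ≤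
      ∫ U, (π (plaquetteHolonomy U 0 0 1)).trace.re * Real.exp (-β * wilsonAction ρ U)
        ∂(Measure.pi fun _ : Edge 4 L => haarProbability G) := by
  classical
  set μ : Measure (GaugeConfig 4 L G) := Measure.pi fun _ : Edge 4 L => haarProbability G with hμ
  set obs : GaugeConfig 4 L G → ℝ := fun U => (π (plaquetteHolonomy U 0 0 1)).trace.re with hobs
  set SA : GaugeConfig 4 L G → ℝ := fun U => ∑ q ∈ A, plaquetteCost ρ U q with hSA
  set R : GaugeConfig 4 L G → ℝ := fun U => Real.exp (-β * ∑ q ∈ Aᶜ, plaquetteCost ρ U q) with hR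
  set T : GaugeConfig 4 L G → ℝ := fun U =>
    ∑ j ∈ Finset.range (k + 1), (-(β * ∑ q ∈ A, plaquetteCost ρ U q)) ^ j / (j.factorial : ℝ) with hT
  show (β ^ k / (k.factorial : ℝ) * (∫ h, (π h).trace.re * ((ρ h).trace.re) ^ k ∂haarProbability G) -
        2 * Cπ * (A.card * (2 * N)) ^ (k + 1) * β ^ (k + 1)) * ∫ U, R U ∂μ ≤
      ∫ U, obs U * Real.exp (-β * wilsonAction ρ U) ∂μ
  have hCπ0 : 0 ≤ Cπ := le_trans (abs_nonneg _) (hCπ 1)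
  -- split of the Boltzmann weight
  have hsplit : ∀ U : GaugeConfig 4 L G, Real.exp (-β * wilsonAction ρ U) = Real.exp (-(β * SA U)) * R U := by
    intro U
    rw [hR, hSA, ← Real.exp_add]
    congr 1
    have : wilsonAction ρ U = ∑ q, plaquetteCost ρ U q := rfl
    rw [this, ← Finset.sum_add_sum_compl A]
    ring
  -- bounds
  have hSA0 : ∀ U, 0 ≤ SA U := fun U => Finset.sum_nonneg fun q _ => (plaquetteCost_bounds ρ hρu U q).1
  have hSAle : ∀ U, SA U ≤ A.card * (2 * N) := fun U => by
    have := Finset.sum_le_card_nsmul A (fun q => plaquetteCost ρ U q) (2 * N) fun q _ => (plaquetteCost_bounds ρ hρu U q).2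
    simpa [nsmul_eq_mul] using this
  have hR0 : ∀ U, 0 ≤ R U := fun U => (Real.exp_pos _).le
  have hRb : ∀ U, |R U| ≤ 1 := fun U => by
    rw [hR, abs_of_nonneg (Real.exp_pos _).le, Real.exp_le_one_iff, neg_mul, neg_nonpos]
    exact mul_nonneg hβ (Finset.sum_nonneg fun q _ => (plaquetteCost_bounds ρ hρu U q).1)
  have hobsb : ∀ U, |obs U| ≤ Cπ := fun U => hCπ _
  -- measurability
  have hobsm : Measurable obs := (Complex.continuous_re.comp hπ.matrix_trace).measurable.comp (measurable_plaquetteHolonomy _ _ _)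
  have hSAm : Measurable SA := Finset.measurable_sum _ fun q _ => measurable_plaquetteCost' ρ hρ q
  have hRm : Measurable R :=
    Real.measurable_exp.comp ((Finset.measurable_sum _ fun q _ => measurable_plaquetteCost' ρ hρ q).const_mul _)
  have hTm : Measurable T := by
    refine Finset.measurable_sum _ fun j _ => ?_
    exact ((hSAm.const_mul β).neg.pow_const j).div_const _
  -- the remainder, pointwise
  have hrem : ∀ U, |obs U * (Real.exp (-(β * SA U)) - T U) * R U| ≤ Cπ * (2 * (β * (A.card * (2 * N))) ^ (k + 1)) * R U := by
    intro U
    rw [abs_mul, abs_mul, abs_of_nonneg (hR0 U)]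
    refine mul_le_mul (mul_le_mul (hobsb U) ?_ (abs_nonneg _) hCπ0) le_rfl (hR0 U) (by positivity)
    have ht1 : β * SA U ≤ 1 := le_trans (mul_le_mul_of_nonneg_left (hSAle U) hβ) hβA
    refine (abs_exp_neg_sub_sum_le (mul_nonneg hβ (hSA0 U)) ht1 k).trans ?_
    exact mul_le_mul_of_nonneg_left (pow_le_pow_left₀ (mul_nonneg hβ (hSA0 U))
      (mul_le_mul_of_nonneg_left (hSAle U) hβ) _) (by norm_num)
  -- integrability
  have hI1 : Integrable (fun U => obs U * T U * R U) μ := by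
    have hexp := integral_obs_taylor_mul_eq π ρ hπ hρ hρu hV A hp₀ hA hβ
    refine Integrable.of_bound (C := Cπ * (∑ j ∈ Finset.range (k + 1), (β * (A.card * (2 * N))) ^ j / (j.factorial : ℝ)) * 1)
      ((hobsm.mul hTm).mul hRm).aestronglyMeasurable (ae_of_all _ fun U => ?_)
    rw [Real.norm_eq_abs, abs_mul, abs_mul]
    refine mul_le_mul (mul_le_mul (hobsb U) ?_ (abs_nonneg _) hCπ0) (hRb U) (abs_nonneg _) (by positivity)
    refine (Finset.abs_sum_le_sum_abs _ _).trans (Finset.sum_le_sum fun j _ => ?_)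
    rw [abs_div, Nat.abs_cast, abs_pow, abs_neg, abs_of_nonneg (mul_nonneg hβ (hSA0 U))]
    exact div_le_div_of_nonneg_right (pow_le_pow_left₀ (mul_nonneg hβ (hSA0 U))
      (mul_le_mul_of_nonneg_left (hSAle U) hβ) _) (by positivity)
  have hI2 : Integrable (fun U => obs U * (Real.exp (-(β * SA U)) - T U) * R U) μ := by
    refine Integrable.of_bound (C := Cπ * (2 * (β * (A.card * (2 * N))) ^ (k + 1)) * 1)
      ((hobsm.mul ((Real.measurable_exp.comp (hSAm.const_mul β).neg).sub hTm)).mul hRm).aestronglyMeasurable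
      (ae_of_all _ fun U => ?_)
    rw [Real.norm_eq_abs]
    refine (hrem U).trans (mul_le_mul_of_nonneg_left ?_ (by positivity))
    simpa only [abs_of_nonneg (hR0 U)] using hRb U
  have hIR : Integrable R μ :=
    Integrable.of_bound (C := 1) hRm.aestronglyMeasurable (ae_of_all _ fun U => by rw [Real.norm_eq_abs]; exact hRb U)
  -- assemble
  have hdecomp : ∀ U, obs U * Real.exp (-β * wilsonAction ρ U) =
      obs U * T U * R U + obs U * (Real.exp (-(β * SA U)) - T U) * R U := fun U => by
    rw [hsplit U]; ring
  simp_rw [hdecomp]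
  rw [integral_add hI1 hI2]
  have h1 : ∫ U, obs U * T U * R U ∂μ =
      (β ^ k / (k.factorial : ℝ)) * (∫ h, (π h).trace.re * ((ρ h).trace.re) ^ k ∂haarProbability G) * ∫ U, R U ∂μ :=
    integral_obs_taylor_mul_eq π ρ hπ hρ hρu hV A hp₀ hA hβ
  have h2 : |∫ U, obs U * (Real.exp (-(β * SA U)) - T U) * R U ∂μ| ≤
      Cπ * (2 * (β * (A.card * (2 * N))) ^ (k + 1)) * ∫ U, R U ∂μ := by
    refine (abs_integral_le_integral_abs).trans ?_
    rw [← integral_const_mul]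
    exact integral_mono hI2.abs (hIR.const_mul _) hrem
  rw [h1]
  have h2' := (abs_le.1 h2).1
  have hrw : Cπ * (2 * (β * (A.card * (2 * N))) ^ (k + 1)) = 2 * Cπ * (A.card * (2 * N)) ^ (k + 1) * β ^ (k + 1) := by
    rw [mul_pow]; ring
  rw [hrw] at h2'
  nlinarith [h2', integral_nonneg_of_ae (μ := μ) (ae_of_all _ hR0)]

omit [Fact (1 < L)] in
/-- **The partition function is at most `∫ R`**: `∫ e^{−βS} dU ≤ ∫ e^{−βS_B} dU` (costs are non-negative). -/
theorem integral_exp_le_integral_R (hρ : Continuous ρ) (hρu : ∀ g, ρ g ∈ Matrix.unitaryGroup (Fin N) ℂ)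
    (A : Finset (Plaquette 4 L)) {β : ℝ} (hβ : 0 ≤ β) :
    ∫ U, Real.exp (-β * wilsonAction ρ U) ∂(Measure.pi fun _ : Edge 4 L => haarProbability G) ≤
      ∫ U, Real.exp (-β * ∑ q ∈ Aᶜ, plaquetteCost ρ U q) ∂(Measure.pi fun _ : Edge 4 L => haarProbability G) := by
  classical
  have hRm : Measurable fun U : GaugeConfig 4 L G => Real.exp (-β * ∑ q ∈ Aᶜ, plaquetteCost ρ U q) :=
    Real.measurable_exp.comp ((Finset.measurable_sum _ fun q _ => measurable_plaquetteCost' ρ hρ q).const_mul _)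
  have hRb : ∀ U : GaugeConfig 4 L G, |Real.exp (-β * ∑ q ∈ Aᶜ, plaquetteCost ρ U q)| ≤ 1 := fun U => by
    rw [abs_of_nonneg (Real.exp_pos _).le, Real.exp_le_one_iff, neg_mul, neg_nonpos]
    exact mul_nonneg hβ (Finset.sum_nonneg fun q _ => (plaquetteCost_bounds ρ hρu U q).1)
  refine integral_mono_of_nonneg (ae_of_all _ fun U => (Real.exp_pos _).le)
    (Integrable.of_bound (C := 1) hRm.aestronglyMeasurable (ae_of_all _ fun U => by rw [Real.norm_eq_abs]; exact hRb U))
    (ae_of_all _ fun U => ?_)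
  refine Real.exp_le_exp.2 ?_
  have : wilsonAction ρ U = ∑ q, plaquetteCost ρ U q := rfl
  rw [this, ← Finset.sum_add_sum_compl A, neg_mul, neg_mul, neg_le_neg_iff, mul_add]
  exact le_add_of_nonneg_left (mul_nonneg hβ (Finset.sum_nonneg fun q _ => (plaquetteCost_bounds ρ hρu U q).1))

end Numerator

end Summit.QuantumFields.YangMills.Cruxes.IR.TensionRatio.PlaquetteFloor

end
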